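import Summits.QuantumFields.YangMills.Theorems.ColdStartUniversalityLatticeLangevinBatchMeans
import Summits.QuantumFields.YangMills.Theorems.ColdStartUniversalityLatticeLangevinBlockMoments
import Summits.QuantumFields.YangMills.Theorems.ColdStartUniversalityLatticeLangevinPoissonEquation
import HarnessLib

/-!
# Route `ColdStartUniversality` (fixed-cut-off SZZ dynamics): ★★★ BATCH MEANS WITH THE SHARP RATE — `E[(σ̂² − σ²)²] ≤ D₄/J + K(2|σ²| + K/b)/b`
# with a `b`-INDEPENDENT diagonal constant `D₄ = 96e^(3/2)(9b₀(b+b₀)+b₀²)²/b² + 2σ⁴` (fourth moments of the blocks, file 90)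

Helper file (seat `ym-line-csu-p1`, g34; `--supports stmt-QuantumFields-24809`).  File 86 bounded the diagonal terms of the batch-means mean-square
error crudely (`I_j² ≤ 4b²`, giving `8b|σ²|/J`), which forces `b = o(√T)` and the rate `O(T^(−1/3))`.  With the fourth-moment bound of file 90
(`E I_j⁴ ≤ 48e^(3/2)(9b₀(b+b₀)+b₀²)² = O(b²)`, `b₀ = 4C/c` the corrector scale) the diagonal constant becomes bounded in `b`, and the estimator's
error is `O(1/J + 1/b)`, i.e. `O(T^(−1/2))` with `b = J = √T`:
* ★★★ `integral_sq_batchMeans_sub_le_sharp_of_prog` — for every realising kernel family, every progressively measurable strong solution of the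
  SU(2) SZZ dynamics from a deterministic start on ANY space, every continuous `|G| ≤ 1`, `b > 0`, `J ≥ 1`:
  `E[((Jb)⁻¹Σ_(j<J) I_j² − σ²)²] ≤ (96·e^(3/2)·(9b₀(b+b₀)+b₀²)²/b² + 2σ⁴)/J + K(2|σ²| + K/b)/b`.
THEOREMS ONLY, no definition, no sorry; [folklore].  HONEST FRAMING: fixed cut-off; `K, b₀` depend on `L, β'`; `UniformColdStartMixing` (24809) is NOT
restated; no crux, rung or summit statement is proved; the Yang–Mills mass gap is NOT proved.
-/

set_option autoImplicit false

noncomputable section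

namespace Summit.QuantumFields.YangMills.Theorems.ColdStartUniversality

open MeasureTheory ProbabilityTheory Filter Topology Set
open scoped NNReal ENNReal BigOperators
open Literature Literature.Probability.Process Literature.MathematicalPhysics.QuantumFieldTheory
open Literature.MathematicalPhysics.QuantumLattice (fundamentalRep fundamentalLatticeRep continuous_fundamentalRep)

variable {L : ℕ} [NeZero L]

/-- ★★★ **Batch means with the sharp rate** (every coupling; `K, b₀` depend on `L, β'`): there are `K ≥ 0`, `b₀ > 0` such that for every realising kernel family `κ`, every strong solution `U` of the SU(2) SZZ dynamics from a deterministic start whose restrictions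
to `[0,i] × Ω` are `𝓑([0,i]) ⊗ 𝓕^W_i`-measurable (e.g. the regular flow), every continuous `G` with `|G| ≤ 1`, every batch length `b > 0` and
number of batches `J ≥ 1`, with `Ĝ = G − μ_(β')G`, `I_j = ∫_(jb,(j+1)b] Ĝ(U_r) dr`, `σ² = 2∫₀^∞∫ Ĝ·κ_tĜ dμ_(β') dt`:
`E[((Jb)⁻¹ Σ_(j<J) I_j² − σ²)²] ≤ (96·e^(3/2)·(9b₀(b+b₀)+b₀²)²/b² + 2(σ²)²)/J + K·(2|σ²| + K/b)/b`. [folklore] -/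
theorem integral_sq_batchMeans_sub_le_sharp_of_prog (L : ℕ) [NeZero L] (β' : ℝ) :
    ∃ K b₀ : ℝ, 0 ≤ K ∧ 0 < b₀ ∧
      ∀ (κ : ℝ≥0 → Kernel (GaugeConfig 3 L (Matrix.specialUnitaryGroup (Fin 2) ℂ))
          (GaugeConfig 3 L (Matrix.specialUnitaryGroup (Fin 2) ℂ))) [∀ t, IsMarkovKernel (κ t)],
        (∀ (t : ℝ≥0) (x : GaugeConfig 3 L (Matrix.specialUnitaryGroup (Fin 2) ℂ))
          (Ω : Type) [MeasurableSpace Ω] (P : Measure Ω) [IsProbabilityMeasure P]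
          (W : ℝ≥0 → Ω → (Edge 3 L × NoiseIdx 2 → ℝ)) (hW : IsFlatBrownian W P)
          (U : ℝ≥0 → Ω → GaugeConfig 3 L (Matrix.specialUnitaryGroup (Fin 2) ℂ)),
          (∀ ω, U 0 ω = x) →
          (latticeLangevinDynamics (fundamentalLatticeRep 2) β').IsSolution (fundamentalRep (Fin 2))
            hW.natFiltration P W U →
          κ t x = P.map (U t)) →
        ∀ (x : GaugeConfig 3 L (Matrix.specialUnitaryGroup (Fin 2) ℂ))
          (Ω : Type) [MeasurableSpace Ω] (P : Measure Ω) [IsProbabilityMeasure P]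
          (W : ℝ≥0 → Ω → (Edge 3 L × NoiseIdx 2 → ℝ)) (hW : IsFlatBrownian W P)
          (U : ℝ≥0 → Ω → GaugeConfig 3 L (Matrix.specialUnitaryGroup (Fin 2) ℂ)),
          (∀ ω, U 0 ω = x) →
          (latticeLangevinDynamics (fundamentalLatticeRep 2) β').IsSolution (fundamentalRep (Fin 2)) hW.natFiltration P W U →
          (∀ i : ℝ≥0, Measurable[@Prod.instMeasurableSpace (Set.Iic i) Ω inferInstance (hW.natFiltration i)]
            (fun q : Set.Iic i × Ω => U q.1 q.2)) →
        ∀ (G : GaugeConfig 3 L (Matrix.specialUnitaryGroup (Fin 2) ℂ) → ℝ), Continuous G → (∀ z, |G z| ≤ 1) →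
        ∀ (b : ℝ), 0 < b → ∀ (J : ℕ), 1 ≤ J →
          ∫ ω, (((J : ℝ) * b)⁻¹ * (∑ j ∈ Finset.range J,
              (∫ r in Ioc ((j : ℝ) * b) (((j : ℝ) + 1) * b), (G (U r.toNNReal ω) - ∫ z, G z ∂(wilsonMeasure (d := 3) (L := L) (fundamentalRep (Fin 2)) β'))) ^ 2) -
              2 * ∫ t in Ioi (0 : ℝ), (∫ y, (G y - ∫ z, G z ∂(wilsonMeasure (d := 3) (L := L) (fundamentalRep (Fin 2)) β')) *
                (∫ z, (G z - ∫ z', G z' ∂(wilsonMeasure (d := 3) (L := L) (fundamentalRep (Fin 2)) β')) ∂(κ t.toNNReal y))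
                ∂(wilsonMeasure (d := 3) (L := L) (fundamentalRep (Fin 2)) β'))) ^ 2 ∂P ≤
            (96 * Real.exp (3 / 2) * (9 * b₀ * (b + b₀) + b₀ ^ 2) ^ 2 / b ^ 2 +
              2 * (2 * ∫ t in Ioi (0 : ℝ), (∫ y, (G y - ∫ z, G z ∂(wilsonMeasure (d := 3) (L := L) (fundamentalRep (Fin 2)) β')) *
                (∫ z, (G z - ∫ z', G z' ∂(wilsonMeasure (d := 3) (L := L) (fundamentalRep (Fin 2)) β')) ∂(κ t.toNNReal y))
                ∂(wilsonMeasure (d := 3) (L := L) (fundamentalRep (Fin 2)) β'))) ^ 2) / J +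
            K * (2 * |2 * ∫ t in Ioi (0 : ℝ), (∫ y, (G y - ∫ z, G z ∂(wilsonMeasure (d := 3) (L := L) (fundamentalRep (Fin 2)) β')) *
                (∫ z, (G z - ∫ z', G z' ∂(wilsonMeasure (d := 3) (L := L) (fundamentalRep (Fin 2)) β')) ∂(κ t.toNNReal y))
                ∂(wilsonMeasure (d := 3) (L := L) (fundamentalRep (Fin 2)) β'))| + K / b) / b := by
  classical
  haveI := secondCountableTopology_su2
  haveI := borelSpace_config L
  obtain ⟨K, hK, hGK⟩ := abs_integral_mul_sq_blockIntegral_sub_le_integral L β'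
  obtain ⟨C₆, c₆, hC₆, hc₆, hP⟩ := exists_poisson_solution L β'
  refine ⟨K, 4 * C₆ / c₆, hK, by positivity, fun κ _ hreal x Ω _ P _ W hW U hU0 hU hprog G hGc hG1 b hb J hJ => ?_⟩
  set b₀ : ℝ := 4 * C₆ / c₆ with hb₀
  set μ : Measure (GaugeConfig 3 L (Matrix.specialUnitaryGroup (Fin 2) ℂ)) :=
    wilsonMeasure (d := 3) (L := L) (fundamentalRep (Fin 2)) β' with hμ
  haveI : IsProbabilityMeasure μ :=
    isProbabilityMeasure_wilsonMeasure (d := 3) (L := L) (fundamentalRep (Fin 2)) (continuous_fundamentalRep (Fin 2)) β'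
  set m : ℝ := ∫ z, G z ∂μ with hm
  have hG : Measurable G := hGc.measurable
  have hm1 : |m| ≤ 1 := by
    have hh := norm_integral_le_of_norm_le_const (μ := μ) (f := G) (C := 1)
      (Eventually.of_forall fun z => by simpa [Real.norm_eq_abs] using hG1 z)
    simpa [Real.norm_eq_abs] using hh
  set Gh : GaugeConfig 3 L (Matrix.specialUnitaryGroup (Fin 2) ℂ) → ℝ := fun z => G z - m with hGh
  have hGhm : Measurable Gh := hG.sub measurable_const
  have hGhb : ∀ z, |Gh z| ≤ 2 := fun z => by
    show |G z - m| ≤ 2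
    have := abs_sub (G z) m
    linarith [hG1 z]
  set σ2 : ℝ := 2 * ∫ t in Ioi (0 : ℝ), (∫ y, Gh y * (∫ z, Gh z ∂(κ t.toNNReal y)) ∂μ) with hσ2
  set S : ℝ := |σ2| with hS
  have hS0 : 0 ≤ S := abs_nonneg _
  have hJr : (0 : ℝ) < J := by exact_mod_cast hJ
  -- measurability of the solution
  have hJm : Measurable fun q : Ω × ℝ => U q.2.toNNReal q.1 :=
    measurable_uncurry_of_prog (Z := U) (fun n : ℕ => hW.natFiltration n) (fun n => hW.natFiltration.le n) (fun n => hprog n)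
  have hUj : Measurable (Function.uncurry U) := by
    have h3 : Measurable fun p : ℝ≥0 × Ω => (p.2, (p.1 : ℝ)) := measurable_snd.prodMk (measurable_fst.coe_nnreal_real)
    have h4 := hJm.comp h3
    have hfun : (Function.uncurry U) = (fun q : Ω × ℝ => U q.2.toNNReal q.1) ∘ (fun p : ℝ≥0 × Ω => (p.2, (p.1 : ℝ))) := by
      funext p; simp [Function.uncurry, Real.toNNReal_coe]
    rw [hfun]; exact h4
  -- the block integrals
  set I : ℕ → Ω → ℝ := fun j ω => ∫ r in Ioc ((j : ℝ) * b) (((j : ℝ) + 1) * b), Gh (U r.toNNReal ω) with hI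
  have hj0 : ∀ j : ℕ, (0 : ℝ) ≤ (j : ℝ) * b := fun j => by positivity
  have hjj : ∀ j : ℕ, (j : ℝ) * b ≤ ((j : ℝ) + 1) * b := fun j => by nlinarith
  have hIb : ∀ j ω, |I j ω| ≤ 2 * b := fun j ω => by
    have hh := norm_setIntegral_le_of_norm_le_const (μ := volume) (s := Ioc ((j : ℝ) * b) (((j : ℝ) + 1) * b)) measure_Ioc_lt_top
      (fun r _ => show ‖Gh (U r.toNNReal ω)‖ ≤ 2 by rw [Real.norm_eq_abs]; exact hGhb _) (f := fun r => Gh (U r.toNNReal ω))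
    rw [Real.norm_eq_abs, Real.volume_real_Ioc_of_le (hjj j)] at hh
    calc |I j ω| ≤ 2 * (((j : ℝ) + 1) * b - (j : ℝ) * b) := hh
      _ = 2 * b := by ring
  have hIF : ∀ j : ℕ, Measurable[hW.natFiltration ((((j : ℝ) + 1) * b).toNNReal)] (I j) := fun j =>
    measurable_setIntegral_path (mΩ := hW.natFiltration ((((j : ℝ) + 1) * b).toNNReal)) ((((j : ℝ) + 1) * b).toNNReal) (hprog _) hGhm (hj0 j)
      (by rw [Real.coe_toNNReal _ ((hj0 j).trans (hjj j))])
  have hIm : ∀ j, Measurable (I j) := fun j => (hIF j).mono (hW.natFiltration.le _) le_rfl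
  -- conditional Green–Kubo at block `k` with a `𝓕_(kb)`-measurable weight
  have hblk : ∀ (k : ℕ) (Z : Ω → ℝ), Measurable[hW.natFiltration (((k : ℝ) * b).toNNReal)] Z → (∀ ω, 0 ≤ Z ω) → ∀ CZ : ℝ, (∀ ω, Z ω ≤ CZ) →
      |(∫ ω, Z ω * I k ω ^ 2 ∂P) - b * σ2 * ∫ ω, Z ω ∂P| ≤ K * ∫ ω, Z ω ∂P := by
    intro k Z hZF hZ0 CZ hZb
    have h := hGK κ hreal x Ω P W hW U hU0 hU hUj G hGc hG1 (((k : ℝ) * b).toNNReal) b hb.le Z hZF hZ0 CZ hZb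
    have hs : (((((k : ℝ) * b).toNNReal : ℝ≥0)) : ℝ) = (k : ℝ) * b := Real.coe_toNNReal _ (hj0 k)
    have hIeq : ∀ ω, (∫ r in Ioc (((((k : ℝ) * b).toNNReal : ℝ≥0)) : ℝ) ((((((k : ℝ) * b).toNNReal : ℝ≥0)) : ℝ) + b), Gh (U r.toNNReal ω)) = I k ω := by
      intro ω; simp only [hI]; rw [hs, add_mul, one_mul]
    have heq : (∫ ω, Z ω * (∫ r in Ioc (((((k : ℝ) * b).toNNReal : ℝ≥0)) : ℝ) ((((((k : ℝ) * b).toNNReal : ℝ≥0)) : ℝ) + b), Gh (U r.toNNReal ω)) ^ 2 ∂P) =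
        ∫ ω, Z ω * I k ω ^ 2 ∂P := integral_congr_ae (ae_of_all _ fun ω => by dsimp only; rw [hIeq ω])
    rw [heq] at h
    have hσ : 2 * b * (∫ t in Ioi (0 : ℝ), (∫ y, Gh y * (∫ z, Gh z ∂(κ t.toNNReal y)) ∂μ)) = b * σ2 := by rw [hσ2]; ring
    rw [hσ] at h
    exact h
  -- the summands `Y_j = I_j²/b − σ²`
  set Y : ℕ → Ω → ℝ := fun j ω => I j ω ^ 2 / b - σ2 with hY
  have hYm : ∀ j, Measurable (Y j) := fun j => (((hIm j).pow_const 2).div_const b).sub measurable_const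
  have hYF : ∀ j : ℕ, Measurable[hW.natFiltration ((((j : ℝ) + 1) * b).toNNReal)] (Y j) := fun j =>
    (((hIF j).pow_const 2).div_const b).sub measurable_const
  have hX4b : ∀ j ω, I j ω ^ 2 / b ≤ 4 * b := fun j ω => by
    rw [div_le_iff₀ hb]
    have h1 := hIb j ω
    have h2 : I j ω ^ 2 = |I j ω| ^ 2 := (sq_abs _).symm
    rw [h2]; nlinarith [abs_nonneg (I j ω)]
  have hX0 : ∀ j ω, 0 ≤ I j ω ^ 2 / b := fun j ω => by positivity
  have hYb : ∀ j ω, |Y j ω| ≤ 4 * b + S := fun j ω => by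
    simp only [hY]
    exact (abs_sub _ _).trans (add_le_add (by rw [abs_of_nonneg (hX0 j ω)]; exact hX4b j ω) le_rfl)
  -- second moments of the blocks: `E[I_j²] ≤ bS + K`
  have hEX : ∀ j, ∫ ω, I j ω ^ 2 / b ∂P ≤ S + K / b := by
    intro j
    have h := hblk j (fun _ => (1 : ℝ)) measurable_const (fun _ => zero_le_one) 1 (fun _ => le_rfl)
    simp only [one_mul, integral_const, smul_eq_mul, probReal_univ, mul_one] at h
    have h2 : ∫ ω, I j ω ^ 2 ∂P ≤ b * S + K := by
      have := (abs_sub_le_iff.1 h).1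
      have h3 : b * σ2 ≤ b * S := mul_le_mul_of_nonneg_left (le_abs_self _) hb.le
      linarith
    rw [integral_div, div_le_iff₀ hb]
    calc ∫ ω, I j ω ^ 2 ∂P ≤ b * S + K := h2
      _ = (S + K / b) * b := by field_simp
  -- the corrector (for the fourth moments of file 90)
  have hGhc : Continuous Gh := hGc.sub continuous_const
  have hGh0 : ∫ z, Gh z ∂μ = 0 := by
    have hGi : Integrable G μ := (integrable_const (1 : ℝ)).mono' hG.aestronglyMeasurable
      (Eventually.of_forall fun z => by simpa [Real.norm_eq_abs] using hG1 z)
    show ∫ z, (G z - m) ∂μ = 0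
    rw [integral_sub hGi (integrable_const m), integral_const, smul_eq_mul, probReal_univ, one_mul, hm, sub_self]
  obtain ⟨u, hu_c, -, hu_b, -, hPois⟩ := hP κ hreal Gh hGhc hGh0 2 hGhb
  have hβu : (0 : ℝ) < 2 * C₆ / c₆ := by positivity
  set M₄ : ℝ := 48 * Real.exp (3 / 2) * (9 * b₀ * (b + b₀) + b₀ ^ 2) ^ 2 with hM₄
  have hI4 : ∀ j, ∫ ω, I j ω ^ 4 ∂P ≤ M₄ := by
    intro j
    have h := (integral_blockIntegral_exp_and_pow_four_le β' κ hreal hGc hG1 hu_c.measurable hβu hu_b hPois x hW hU0 hU hprog hb j).2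
    have hb₀' : 2 * (2 * C₆ / c₆) = b₀ := by rw [hb₀]; ring
    rw [hb₀'] at h
    exact h
  -- diagonal terms
  set D : ℝ := 2 * M₄ / b ^ 2 + 2 * σ2 ^ 2 with hD
  have hD0 : 0 ≤ D := by positivity
  have hdiag : ∀ j, |∫ ω, Y j ω * Y j ω ∂P| ≤ D := by
    intro j
    have hI4i : Integrable (fun ω => I j ω ^ 4) P := (integrable_const ((2 * b) ^ 4)).mono' ((hIm j).pow_const 4).aestronglyMeasurable
      (Eventually.of_forall fun ω => by
        rw [Real.norm_eq_abs, abs_of_nonneg (by positivity), show I j ω ^ 4 = |I j ω| ^ 4 by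
          rw [show (4 : ℕ) = 2 * 2 from rfl, pow_mul, pow_mul, sq_abs]]
        exact pow_le_pow_left₀ (abs_nonneg _) (hIb j ω) 4)
    have hpt : ∀ ω, Y j ω * Y j ω ≤ 2 / b ^ 2 * I j ω ^ 4 + 2 * σ2 ^ 2 := fun ω => by
      simp only [hY]
      have h1 : (I j ω ^ 2 / b - σ2) * (I j ω ^ 2 / b - σ2) ≤ 2 * (I j ω ^ 2 / b) ^ 2 + 2 * σ2 ^ 2 := by
        nlinarith [sq_nonneg (I j ω ^ 2 / b + σ2)]
      have h2 : (I j ω ^ 2 / b) ^ 2 = I j ω ^ 4 / b ^ 2 := by rw [div_pow]; ring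
      rw [h2] at h1
      calc (I j ω ^ 2 / b - σ2) * (I j ω ^ 2 / b - σ2) ≤ 2 * (I j ω ^ 4 / b ^ 2) + 2 * σ2 ^ 2 := h1
        _ = 2 / b ^ 2 * I j ω ^ 4 + 2 * σ2 ^ 2 := by ring
    have hnn : ∀ ω, 0 ≤ Y j ω * Y j ω := fun ω => mul_self_nonneg _
    have hYYi : Integrable (fun ω => Y j ω * Y j ω) P := (integrable_const ((4 * b + S) * (4 * b + S))).mono'
      ((hYm j).mul (hYm j)).aestronglyMeasurable (Eventually.of_forall fun ω => by
        rw [Real.norm_eq_abs, abs_mul]; exact mul_le_mul (hYb j ω) (hYb j ω) (abs_nonneg _) (by positivity))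
    rw [abs_of_nonneg (integral_nonneg hnn)]
    calc ∫ ω, Y j ω * Y j ω ∂P ≤ ∫ ω, (2 / b ^ 2 * I j ω ^ 4 + 2 * σ2 ^ 2) ∂P :=
          integral_mono hYYi ((hI4i.const_mul _).add (integrable_const _)) hpt
      _ = 2 / b ^ 2 * (∫ ω, I j ω ^ 4 ∂P) + 2 * σ2 ^ 2 := by
          rw [integral_add (hI4i.const_mul _) (integrable_const _), integral_const_mul, integral_const, smul_eq_mul, probReal_univ, one_mul]
      _ ≤ 2 / b ^ 2 * M₄ + 2 * σ2 ^ 2 := by gcongr; exact hI4 j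
      _ = D := by rw [hD]; ring
  -- off-diagonal terms: condition on `𝓕_(kb)` with the weights `Y_j^±`, `j < k`
  set ρ : ℝ := K * (2 * S + K / b) / b with hρ
  have hρ0 : 0 ≤ ρ := by positivity
  have hcross : ∀ j k : ℕ, j < k → |∫ ω, Y j ω * Y k ω ∂P| ≤ ρ := by
    intro j k hjk
    have hle : ((((j : ℝ) + 1) * b).toNNReal) ≤ (((k : ℝ) * b).toNNReal) :=
      Real.toNNReal_le_toNNReal (mul_le_mul_of_nonneg_right (by exact_mod_cast Nat.succ_le_of_lt hjk) hb.le)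
    -- positive and negative parts of `Y_j`
    set Zp : Ω → ℝ := fun ω => max (Y j ω) 0 with hZp
    set Zn : Ω → ℝ := fun ω => max (-Y j ω) 0 with hZn
    have hZpF : Measurable[hW.natFiltration (((k : ℝ) * b).toNNReal)] Zp := ((hYF j).mono (hW.natFiltration.mono hle) le_rfl).max measurable_const
    have hZnF : Measurable[hW.natFiltration (((k : ℝ) * b).toNNReal)] Zn := ((hYF j).mono (hW.natFiltration.mono hle) le_rfl).neg.max measurable_const
    have hZp0 : ∀ ω, 0 ≤ Zp ω := fun ω => le_max_right _ _
    have hZn0 : ∀ ω, 0 ≤ Zn ω := fun ω => le_max_right _ _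
    have hZpb : ∀ ω, Zp ω ≤ 4 * b + S := fun ω => max_le ((le_abs_self _).trans (hYb j ω)) (by positivity)
    have hZnb : ∀ ω, Zn ω ≤ 4 * b + S := fun ω => max_le ((neg_le_abs _).trans (hYb j ω)) (by positivity)
    have hsplit : ∀ ω, Y j ω = Zp ω - Zn ω := fun ω => by simp only [hZp, hZn]; rcases le_total 0 (Y j ω) with h | h <;> simp [h, neg_nonpos.2, neg_nonneg.2]
    have habsY : ∀ ω, Zp ω + Zn ω = |Y j ω| := fun ω => by simp only [hZp, hZn]; rcases le_total 0 (Y j ω) with h | h <;> simp [h, neg_nonpos.2, neg_nonneg.2, abs_of_nonneg, abs_of_nonpos]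
    have hp := hblk k Zp hZpF hZp0 _ hZpb
    have hn := hblk k Zn hZnF hZn0 _ hZnb
    -- integrability
    have hZpm : Measurable Zp := hZpF.mono (hW.natFiltration.le _) le_rfl
    have hZnm : Measurable Zn := hZnF.mono (hW.natFiltration.le _) le_rfl
    have hInt : ∀ {φ ψ : Ω → ℝ} {Cφ Cψ : ℝ}, Measurable φ → Measurable ψ → (∀ ω, |φ ω| ≤ Cφ) → (∀ ω, |ψ ω| ≤ Cψ) →
        Integrable (fun ω => φ ω * ψ ω) P := fun {φ ψ Cφ Cψ} hφ hψ hφb hψb =>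
      (integrable_const (Cφ * Cψ)).mono' (hφ.mul hψ).aestronglyMeasurable (Eventually.of_forall fun ω => by
        rw [norm_mul, Real.norm_eq_abs, Real.norm_eq_abs]
        exact mul_le_mul (hφb ω) (hψb ω) (abs_nonneg _) ((abs_nonneg _).trans (hφb ω)))
    have hZpa : ∀ ω, |Zp ω| ≤ 4 * b + S := fun ω => by rw [abs_of_nonneg (hZp0 ω)]; exact hZpb ω
    have hZna : ∀ ω, |Zn ω| ≤ 4 * b + S := fun ω => by rw [abs_of_nonneg (hZn0 ω)]; exact hZnb ω
    have hI2a : ∀ ω, |I k ω ^ 2| ≤ 4 * b * b := fun ω => by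
      rw [abs_of_nonneg (sq_nonneg _)]; have := hX4b k ω; rwa [div_le_iff₀ hb] at this
    have i1 : Integrable (fun ω => Zp ω * I k ω ^ 2) P := hInt hZpm ((hIm k).pow_const 2) hZpa hI2a
    have i2 : Integrable (fun ω => Zn ω * I k ω ^ 2) P := hInt hZnm ((hIm k).pow_const 2) hZna hI2a
    have iZp : Integrable Zp P := (integrable_const (4 * b + S)).mono' hZpm.aestronglyMeasurable (Eventually.of_forall fun ω => by
      rw [Real.norm_eq_abs]; exact hZpa ω)
    have iZn : Integrable Zn P := (integrable_const (4 * b + S)).mono' hZnm.aestronglyMeasurable (Eventually.of_forall fun ω => by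
      rw [Real.norm_eq_abs]; exact hZna ω)
    -- `E[Y_j Y_k] = (E[Zp I_k²] − bσ² E Zp)/b − (E[Zn I_k²] − bσ² E Zn)/b`
    have heq : ∫ ω, Y j ω * Y k ω ∂P = ((∫ ω, Zp ω * I k ω ^ 2 ∂P) - b * σ2 * ∫ ω, Zp ω ∂P) / b -
        ((∫ ω, Zn ω * I k ω ^ 2 ∂P) - b * σ2 * ∫ ω, Zn ω ∂P) / b := by
      have hpt : ∀ ω, Y j ω * Y k ω = (Zp ω * I k ω ^ 2 / b - σ2 * Zp ω) - (Zn ω * I k ω ^ 2 / b - σ2 * Zn ω) := fun ω => by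
        rw [hsplit ω]; simp only [hY]; ring
      rw [integral_congr_ae (ae_of_all _ hpt),
        integral_sub (f := fun ω => Zp ω * I k ω ^ 2 / b - σ2 * Zp ω) (g := fun ω => Zn ω * I k ω ^ 2 / b - σ2 * Zn ω)
          ((i1.div_const b).sub (iZp.const_mul σ2)) ((i2.div_const b).sub (iZn.const_mul σ2)),
        integral_sub (i1.div_const b) (iZp.const_mul σ2), integral_sub (i2.div_const b) (iZn.const_mul σ2),
        integral_div, integral_div, integral_const_mul, integral_const_mul]
      field_simp
    rw [heq]
    have hEabs : (∫ ω, Zp ω ∂P) + ∫ ω, Zn ω ∂P ≤ 2 * S + K / b := by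
      rw [← integral_add iZp iZn, integral_congr_ae (ae_of_all _ habsY)]
      -- `E|Y_j| ≤ E[I_j²/b] + S ≤ 2S + K/b`
      have hYabs : ∀ ω, |Y j ω| ≤ I j ω ^ 2 / b + S := fun ω => by
        simp only [hY]; exact (abs_sub _ _).trans (by rw [abs_of_nonneg (hX0 j ω)])
      have hIi : Integrable (fun ω => I j ω ^ 2 / b) P := (integrable_const (4 * b)).mono' (((hIm j).pow_const 2).div_const b).aestronglyMeasurable
        (Eventually.of_forall fun ω => by rw [Real.norm_eq_abs, abs_of_nonneg (hX0 j ω)]; exact hX4b j ω)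
      have hYai : Integrable (fun ω => |Y j ω|) P := ((integrable_const (4 * b + S)).mono' (hYm j).aestronglyMeasurable
        (Eventually.of_forall fun ω => by rw [Real.norm_eq_abs]; exact hYb j ω)).abs
      calc ∫ ω, |Y j ω| ∂P ≤ ∫ ω, (I j ω ^ 2 / b + S) ∂P := integral_mono hYai (hIi.add (integrable_const _)) hYabs
        _ = (∫ ω, I j ω ^ 2 / b ∂P) + S := by rw [integral_add hIi (integrable_const _), integral_const, smul_eq_mul, probReal_univ, one_mul]
        _ ≤ (S + K / b) + S := by linarith [hEX j]
        _ = 2 * S + K / b := by ring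
    have hp' : |((∫ ω, Zp ω * I k ω ^ 2 ∂P) - b * σ2 * ∫ ω, Zp ω ∂P) / b| ≤ K * (∫ ω, Zp ω ∂P) / b := by
      rw [abs_div, abs_of_pos hb]; exact div_le_div_of_nonneg_right hp hb.le
    have hn' : |((∫ ω, Zn ω * I k ω ^ 2 ∂P) - b * σ2 * ∫ ω, Zn ω ∂P) / b| ≤ K * (∫ ω, Zn ω ∂P) / b := by
      rw [abs_div, abs_of_pos hb]; exact div_le_div_of_nonneg_right hn hb.le
    calc |((∫ ω, Zp ω * I k ω ^ 2 ∂P) - b * σ2 * ∫ ω, Zp ω ∂P) / b - ((∫ ω, Zn ω * I k ω ^ 2 ∂P) - b * σ2 * ∫ ω, Zn ω ∂P) / b|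
        ≤ K * (∫ ω, Zp ω ∂P) / b + K * (∫ ω, Zn ω ∂P) / b := (abs_sub _ _).trans (add_le_add hp' hn')
      _ = K * ((∫ ω, Zp ω ∂P) + ∫ ω, Zn ω ∂P) / b := by ring
      _ ≤ K * (2 * S + K / b) / b := by gcongr
      _ = ρ := by rw [hρ]
  have hoff : ∀ j k : ℕ, j < J → k < J → j ≠ k → |∫ ω, Y j ω * Y k ω ∂P| ≤ ρ := by
    intro j k _ _ hjk
    rcases lt_or_gt_of_ne hjk with h | h
    · exact hcross j k h
    · have hcomm : ∫ ω, Y j ω * Y k ω ∂P = ∫ ω, Y k ω * Y j ω ∂P := integral_congr_ae (ae_of_all _ fun ω => mul_comm _ _)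
      rw [hcomm]; exact hcross k j h
  -- the mean-square error as a double sum
  have hYYi : ∀ j k, Integrable (fun ω => Y j ω * Y k ω) P := fun j k =>
    (integrable_const ((4 * b + S) * (4 * b + S))).mono' ((hYm j).mul (hYm k)).aestronglyMeasurable (Eventually.of_forall fun ω => by
      rw [Real.norm_eq_abs, abs_mul]; exact mul_le_mul (hYb j ω) (hYb k ω) (abs_nonneg _) (by positivity))
  have hest : ∀ ω, ((J : ℝ) * b)⁻¹ * (∑ j ∈ Finset.range J, I j ω ^ 2) - σ2 = (J : ℝ)⁻¹ * ∑ j ∈ Finset.range J, Y j ω := by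
    intro ω
    simp only [hY, Finset.sum_sub_distrib, Finset.sum_const, Finset.card_range, nsmul_eq_mul]
    rw [mul_sub, ← mul_assoc, inv_mul_cancel₀ hJr.ne', one_mul, mul_inv, Finset.mul_sum, Finset.mul_sum]
    congr 1
    exact Finset.sum_congr rfl fun j _ => by rw [div_eq_mul_inv, mul_comm (I j ω ^ 2), mul_assoc, mul_comm b⁻¹]
  have hsq : ∀ ω, ((J : ℝ)⁻¹ * ∑ j ∈ Finset.range J, Y j ω) ^ 2 =
      (J : ℝ)⁻¹ ^ 2 * ∑ j ∈ Finset.range J, ∑ k ∈ Finset.range J, Y j ω * Y k ω := fun ω => by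
    rw [mul_pow, sq (∑ j ∈ Finset.range J, Y j ω), Finset.sum_mul_sum]
  have hmain : ∫ ω, (∑ j ∈ Finset.range J, ∑ k ∈ Finset.range J, Y j ω * Y k ω) ∂P ≤ J * D + (J : ℝ) ^ 2 * ρ := by
    rw [integral_finsetSum _ fun j _ => integrable_finsetSum _ fun k _ => hYYi j k]
    rw [Finset.sum_congr rfl fun j _ => integral_finsetSum _ fun k _ => hYYi j k]
    exact sum_sum_le_of_diag_offdiag hρ0 J (fun j _ => hdiag j) hoff
  have hDeq : 96 * Real.exp (3 / 2) * (9 * b₀ * (b + b₀) + b₀ ^ 2) ^ 2 / b ^ 2 + 2 * σ2 ^ 2 = D := by rw [hD, hM₄]; ring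
  rw [hDeq]
  show ∫ ω, (((J : ℝ) * b)⁻¹ * (∑ j ∈ Finset.range J, I j ω ^ 2) - σ2) ^ 2 ∂P ≤ D / J + ρ
  calc ∫ ω, (((J : ℝ) * b)⁻¹ * (∑ j ∈ Finset.range J, I j ω ^ 2) - σ2) ^ 2 ∂P
      = ∫ ω, (J : ℝ)⁻¹ ^ 2 * ∑ j ∈ Finset.range J, ∑ k ∈ Finset.range J, Y j ω * Y k ω ∂P :=
        integral_congr_ae (ae_of_all _ fun ω => by dsimp only; rw [hest ω, hsq ω])
    _ = (J : ℝ)⁻¹ ^ 2 * ∫ ω, (∑ j ∈ Finset.range J, ∑ k ∈ Finset.range J, Y j ω * Y k ω) ∂P := integral_const_mul _ _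
    _ ≤ (J : ℝ)⁻¹ ^ 2 * (J * D + (J : ℝ) ^ 2 * ρ) := mul_le_mul_of_nonneg_left hmain (by positivity)
    _ = D / J + ρ := by field_simp

end Summit.QuantumFields.YangMills.Theorems.ColdStartUniversality

end
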